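import Literature.Topology.FourManifolds.LefschetzBaseCover
import HarnessLib

/-!
# N3 (`stub_STgeo`) ▸ N3-nat ▸ N3d-1 `node_stabBaseData` ▸ G1c: THE FIBRED RETRACTION OF `Base g` ONTO ITS FLAT PART
# `‖x‖ ≤ 2` (the continuity device of the clause `shadow_embed`)
(wave 8, brick J6-6 of stub `stub_STgeo` = node N3 of NF4, line `modp-braid-orbits`, crux
`ConvexBisection.AcyclicBisectionExists`, item stmt-SmoothPoincare4-10508; registered sub-goal `helper_baseRetract`;
report H6 §4(d): the 1-handle presentation `E.jA` of N3d-1 has no continuous extension over the four cores, so the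
globally continuous map fed to G7-4 `shadow_comp_eq_embed` is `ι = E.jA ∘ r` with `r` THIS retraction — continuous on all
of `Base g`, the identity on `‖x‖ ≤ 2` (all flat pages, all chain loops), with values in `‖x‖ ≤ 2` (off cores placed on
the binding `‖x‖ = R > 2`), and fibred.)

* `baseRetractAmb g p`: `p` if `‖x‖ ≤ 2`, else `(2x/‖x‖, y · √((2/‖x‖)^{2g+1}) · √(1 + c/X^{2g+1}) / √(1 + c/x^{2g+1}))`,
  `c = y² − x^{2g+1} = 1 + w`, `X = 2x/‖x‖` (principal roots of numbers of real part `≥ 1/4`);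
* `w_baseRetractAmb` (`w` is preserved), `norm_cx_baseRetractAmb_le` (`‖x'‖ ≤ 2`), `rho_baseRetractAmb_le`,
  `continuousOn_baseRetractAmb` (on `‖w‖ ≤ 1/2`);
* **`baseRetract g : Base g → Base g`**: `continuous_baseRetract`, `baseRetract_eq_self (‖x‖ ≤ 2)`,
  `norm_cx_baseRetract_le`, `w_baseRetract` — registered `helper_baseRetract`.

Everything is proved; two definitions, no named facts.  References: J. Milnor, *Singular points of complex hypersurfaces*
(1968), §9 [Milnor1968].
-/

noncomputable section

-- the prescribed namespace `Summit.<P>.<Sub>.…` duplicates `SmoothPoincare4` (P = Sub)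
set_option linter.dupNamespace false

open scoped Topology Real
open Set Function Metric
open Literature.Topology.FourManifolds Literature.Topology.FourManifolds.LefschetzBase

namespace Summit.SmoothPoincare4.SmoothPoincare4.Theorems.AcyclicBisectionExists.ModpBraidOrbits

namespace StabBase

variable {g : ℕ}

/-! ## The ambient formula -/

/-- **The fibred radial retraction of `ℂ²` onto `‖x‖ ≤ 2`** (junk where `‖w‖ > 1/2`). [cite: Milnor1968, §9] -/
def baseRetractAmb (g : ℕ) (p : EuclideanSpace ℝ (Fin 4)) : EuclideanSpace ℝ (Fin 4) :=
  if ‖cx p‖ ≤ 2 then p else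
    mk (((2 / ‖cx p‖ : ℝ) : ℂ) * cx p)
      (cy p * ((Real.sqrt ((2 / ‖cx p‖) ^ (2 * g + 1)) : ℝ) : ℂ) *
        csqrt (1 + (cy p ^ 2 - cx p ^ (2 * g + 1)) / ((((2 / ‖cx p‖ : ℝ) : ℂ) * cx p) ^ (2 * g + 1))) /
        csqrt (1 + (cy p ^ 2 - cx p ^ (2 * g + 1)) / cx p ^ (2 * g + 1)))

/-- On `‖x‖ ≤ 2` the retraction is the identity. [folklore] -/
theorem baseRetractAmb_of_le {p : EuclideanSpace ℝ (Fin 4)} (h : ‖cx p‖ ≤ 2) : baseRetractAmb g p = p := by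
  simp [baseRetractAmb, h]

/-- `c = y² − x^{2g+1} = 1 + w`. [folklore] -/
theorem cy_sq_sub_eq (p : EuclideanSpace ℝ (Fin 4)) : cy p ^ 2 - cx p ^ (2 * g + 1) = 1 + w g p := by
  simp only [w, Phi]; ring

/-- The estimates over `‖x‖ ≥ 2`, `‖w‖ ≤ 1/2`: `‖c‖ ≤ 3/2 < 2 ≤ ‖x^{2g+1}‖`, `= ‖X^{2g+1}‖`… [folklore] -/
theorem retract_estimates {p : EuclideanSpace ℝ (Fin 4)} (hx : 2 ≤ ‖cx p‖) (hw : ‖w g p‖ ≤ 1 / 2) :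
    ‖cy p ^ 2 - cx p ^ (2 * g + 1)‖ ≤ 3 / 2 ∧ 2 ≤ ‖cx p ^ (2 * g + 1)‖ ∧
      ‖(((2 / ‖cx p‖ : ℝ) : ℂ) * cx p) ^ (2 * g + 1)‖ = 2 ^ (2 * g + 1) ∧ cy p ≠ 0 ∧ cx p ≠ 0 := by
  have hx0 : cx p ≠ 0 := by
    intro h0; rw [h0, norm_zero] at hx; linarith
  have hc : ‖cy p ^ 2 - cx p ^ (2 * g + 1)‖ ≤ 3 / 2 := by
    rw [cy_sq_sub_eq]
    calc ‖1 + w g p‖ ≤ ‖(1 : ℂ)‖ + ‖w g p‖ := norm_add_le _ _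
      _ ≤ 3 / 2 := by rw [norm_one]; linarith
  have ha : 2 ≤ ‖cx p ^ (2 * g + 1)‖ := by
    rw [norm_pow]
    calc (2 : ℝ) ≤ 2 ^ (2 * g + 1) := by
          calc (2 : ℝ) = 2 ^ 1 := (pow_one 2).symm
            _ ≤ 2 ^ (2 * g + 1) := pow_le_pow_right₀ (by norm_num) (by omega)
      _ ≤ ‖cx p‖ ^ (2 * g + 1) := pow_le_pow_left₀ (by norm_num) hx _
  have hX : ‖(((2 / ‖cx p‖ : ℝ) : ℂ) * cx p) ^ (2 * g + 1)‖ = 2 ^ (2 * g + 1) := by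
    rw [norm_pow, norm_mul, Complex.norm_real, Real.norm_eq_abs, abs_of_pos (by positivity)]
    have : 2 / ‖cx p‖ * ‖cx p‖ = 2 := by field_simp
    rw [this]
  have hy : cy p ≠ 0 := by
    intro h0
    have e : cy p ^ 2 - cx p ^ (2 * g + 1) = -(cx p ^ (2 * g + 1)) := by rw [h0]; ring
    rw [e, norm_neg] at hc
    linarith
  exact ⟨hc, ha, hX, hy, hx0⟩

/-- `1 + c/a` has real part `≥ 1/4` when `‖c‖ ≤ 3/2`, `‖a‖ ≥ 2`. [folklore] -/
theorem re_one_add_div_ge {c a : ℂ} (hc : ‖c‖ ≤ 3 / 2) (ha : 2 ≤ ‖a‖) : 1 / 4 ≤ (1 + c / a).re := by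
  have h1 : ‖c / a‖ ≤ 3 / 4 := by
    rw [norm_div]
    rw [div_le_iff₀ (by linarith)]
    linarith
  have h2 : |(c / a).re| ≤ ‖c / a‖ := Complex.abs_re_le_norm _
  rw [Complex.add_re, Complex.one_re]
  linarith [neg_abs_le (c / a).re]

/-- The denominator root does not vanish. [folklore] -/
theorem csqrt_ne_zero_of_re_pos {z : ℂ} (hz : 0 < z.re) : csqrt z ≠ 0 := by
  intro h0
  have := csqrt_sq z
  rw [h0] at this
  have e : z = 0 := by rw [← this]; ring
  rw [e, Complex.zero_re] at hz
  exact lt_irrefl _ hz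

/-- **`w` is preserved**: `w (baseRetractAmb g p) = w g p` (`‖w‖ ≤ 1/2`). [cite: Milnor1968, §9] -/
theorem w_baseRetractAmb {p : EuclideanSpace ℝ (Fin 4)} (hw : ‖w g p‖ ≤ 1 / 2) : w g (baseRetractAmb g p) = w g p := by
  rcases le_or_gt ‖cx p‖ 2 with h | h
  · rw [baseRetractAmb_of_le h]
  · obtain ⟨hc, ha, hX, hy, hx0⟩ := retract_estimates h.le hw
    set c : ℂ := cy p ^ 2 - cx p ^ (2 * g + 1) with hcdef
    set s : ℝ := 2 / ‖cx p‖ with hs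
    set X : ℂ := ((s : ℝ) : ℂ) * cx p with hXdef
    have hs0 : 0 < s := by positivity
    have hXa : 2 ≤ ‖X ^ (2 * g + 1)‖ := by
      rw [hX]
      calc (2 : ℝ) = 2 ^ 1 := (pow_one 2).symm
        _ ≤ 2 ^ (2 * g + 1) := pow_le_pow_right₀ (by norm_num) (by omega)
    have hv : 0 < (1 + c / cx p ^ (2 * g + 1)).re := lt_of_lt_of_le (by norm_num) (re_one_add_div_ge hc ha)
    have hu : 0 < (1 + c / X ^ (2 * g + 1)).re := lt_of_lt_of_le (by norm_num) (re_one_add_div_ge hc hXa)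
    have hden : csqrt (1 + c / cx p ^ (2 * g + 1)) ≠ 0 := csqrt_ne_zero_of_re_pos hv
    have hv0 : 1 + c / cx p ^ (2 * g + 1) ≠ 0 := by
      intro h0; rw [h0, Complex.zero_re] at hv; exact lt_irrefl _ hv
    have ha0 : cx p ^ (2 * g + 1) ≠ 0 := pow_ne_zero _ hx0
    have hX0 : X ^ (2 * g + 1) ≠ 0 := pow_ne_zero _ (mul_ne_zero (by exact_mod_cast hs0.ne') hx0)
    -- the new `y²`
    have key : (cy p * ((Real.sqrt (s ^ (2 * g + 1)) : ℝ) : ℂ) * csqrt (1 + c / X ^ (2 * g + 1)) /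
        csqrt (1 + c / cx p ^ (2 * g + 1))) ^ 2 = X ^ (2 * g + 1) + c := by
      rw [div_pow, mul_pow, mul_pow, csqrt_sq, csqrt_sq, ← Complex.ofReal_pow, Real.sq_sqrt (by positivity)]
      have e1 : cy p ^ 2 = cx p ^ (2 * g + 1) + c := by rw [hcdef]; ring
      have e2 : X ^ (2 * g + 1) = ((s ^ (2 * g + 1) : ℝ) : ℂ) * cx p ^ (2 * g + 1) := by
        rw [hXdef, mul_pow]; push_cast; ring
      have hyc : cx p ^ (2 * g + 1) + c ≠ 0 := by rw [← e1]; exact pow_ne_zero 2 hy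
      have hsC : ((s ^ (2 * g + 1) : ℝ) : ℂ) ≠ 0 := by exact_mod_cast (pow_pos hs0 _).ne'
      rw [e1, e2]
      have hSa : ((s ^ (2 * g + 1) : ℝ) : ℂ) * cx p ^ (2 * g + 1) ≠ 0 := mul_ne_zero hsC ha0
      rw [one_add_div hSa, one_add_div ha0]
      field_simp
    have hif : ¬‖cx p‖ ≤ 2 := not_le.2 h
    simp only [baseRetractAmb, hif, if_false, w, Phi, cx_mk, cy_mk]
    rw [← hcdef, ← hs, ← hXdef, key, hcdef]
    ring

/-- **`‖x‖ ≤ 2` after retraction.** [folklore] -/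
theorem norm_cx_baseRetractAmb_le (p : EuclideanSpace ℝ (Fin 4)) : ‖cx (baseRetractAmb g p)‖ ≤ 2 := by
  rcases le_or_gt ‖cx p‖ 2 with h | h
  · rw [baseRetractAmb_of_le h]; exact h
  · have hif : ¬‖cx p‖ ≤ 2 := not_le.2 h
    simp only [baseRetractAmb, hif, if_false, cx_mk]
    rw [norm_mul, Complex.norm_real, Real.norm_eq_abs, abs_of_pos (by positivity)]
    have : 2 / ‖cx p‖ * ‖cx p‖ = 2 := by field_simp
    rw [this]

/-- **`rho` does not increase** (so `Base g` is mapped into `Base g`). [folklore] -/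
theorem rho_baseRetractAmb_le {p : EuclideanSpace ℝ (Fin 4)} (hw : ‖w g p‖ ≤ 1 / 2) :
    rho g (baseRetractAmb g p) ≤ rho g p := by
  unfold rho
  rw [w_baseRetractAmb hw, eta_of_le (by nlinarith [norm_cx_baseRetractAmb_le (g := g) p, norm_nonneg (cx (baseRetractAmb g p))])]
  linarith [eta_nonneg (‖cx p‖ ^ 2)]

/-- **Continuity of the outer formula** on `{‖x‖ ≥ 2, ‖w‖ ≤ 1/2}`. [folklore] -/
theorem continuousOn_baseRetractAmb_outer :
    ContinuousOn (fun p : EuclideanSpace ℝ (Fin 4) =>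
      mk (((2 / ‖cx p‖ : ℝ) : ℂ) * cx p)
        (cy p * ((Real.sqrt ((2 / ‖cx p‖) ^ (2 * g + 1)) : ℝ) : ℂ) *
          csqrt (1 + (cy p ^ 2 - cx p ^ (2 * g + 1)) / ((((2 / ‖cx p‖ : ℝ) : ℂ) * cx p) ^ (2 * g + 1))) /
          csqrt (1 + (cy p ^ 2 - cx p ^ (2 * g + 1)) / cx p ^ (2 * g + 1))))
      {p | 2 ≤ ‖cx p‖ ∧ ‖w g p‖ ≤ 1 / 2} := by
  have hcx : Continuous (cx : EuclideanSpace ℝ (Fin 4) → ℂ) := contDiff_cx.continuous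
  have hcy : Continuous (cy : EuclideanSpace ℝ (Fin 4) → ℂ) := contDiff_cy.continuous
  have hs : ContinuousOn (fun p : EuclideanSpace ℝ (Fin 4) => (2 / ‖cx p‖ : ℝ)) {p | 2 ≤ ‖cx p‖ ∧ ‖w g p‖ ≤ 1 / 2} :=
    continuousOn_const.div hcx.norm.continuousOn fun p hp => by have := hp.1; positivity
  have hsC : ContinuousOn (fun p : EuclideanSpace ℝ (Fin 4) => (((2 / ‖cx p‖ : ℝ)) : ℂ))
      {p | 2 ≤ ‖cx p‖ ∧ ‖w g p‖ ≤ 1 / 2} := Complex.continuous_ofReal.comp_continuousOn hs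
  have hX : ContinuousOn (fun p : EuclideanSpace ℝ (Fin 4) => (((2 / ‖cx p‖ : ℝ)) : ℂ) * cx p)
      {p | 2 ≤ ‖cx p‖ ∧ ‖w g p‖ ≤ 1 / 2} := hsC.mul hcx.continuousOn
  have hc : Continuous fun p : EuclideanSpace ℝ (Fin 4) => cy p ^ 2 - cx p ^ (2 * g + 1) := (hcy.pow 2).sub (hcx.pow _)
  have hsq : ContinuousOn csqrt {z : ℂ | 0 ≤ z.re} := fun z hz => (continuousAt_csqrt hz).continuousWithinAt
  have hU : ContinuousOn (fun p : EuclideanSpace ℝ (Fin 4) =>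
      csqrt (1 + (cy p ^ 2 - cx p ^ (2 * g + 1)) / ((((2 / ‖cx p‖ : ℝ) : ℂ) * cx p) ^ (2 * g + 1))))
      {p | 2 ≤ ‖cx p‖ ∧ ‖w g p‖ ≤ 1 / 2} := by
    refine hsq.comp (continuousOn_const.add (hc.continuousOn.div (hX.pow _) fun p hp => ?_)) fun p hp => ?_
    · obtain ⟨-, -, hXn, -, -⟩ := retract_estimates hp.1 hp.2
      intro h0; rw [h0, norm_zero] at hXn; exact absurd hXn (by positivity)
    · obtain ⟨hcn, -, hXn, -, -⟩ := retract_estimates hp.1 hp.2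
      have : 2 ≤ ‖(((2 / ‖cx p‖ : ℝ) : ℂ) * cx p) ^ (2 * g + 1)‖ := by
        rw [hXn]
        calc (2 : ℝ) = 2 ^ 1 := (pow_one 2).symm
          _ ≤ 2 ^ (2 * g + 1) := pow_le_pow_right₀ (by norm_num) (by omega)
      exact le_trans (by norm_num) (re_one_add_div_ge hcn this)
  have hV : ContinuousOn (fun p : EuclideanSpace ℝ (Fin 4) => csqrt (1 + (cy p ^ 2 - cx p ^ (2 * g + 1)) / cx p ^ (2 * g + 1)))
      {p | 2 ≤ ‖cx p‖ ∧ ‖w g p‖ ≤ 1 / 2} := by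
    refine hsq.comp (continuousOn_const.add (hc.continuousOn.div (hcx.pow _).continuousOn fun p hp => ?_)) fun p hp => ?_
    · exact pow_ne_zero _ (retract_estimates hp.1 hp.2).2.2.2.2
    · obtain ⟨hcn, han, -, -, -⟩ := retract_estimates hp.1 hp.2
      exact le_trans (by norm_num) (re_one_add_div_ge hcn han)
  have hV0 : ∀ p ∈ {p : EuclideanSpace ℝ (Fin 4) | 2 ≤ ‖cx p‖ ∧ ‖w g p‖ ≤ 1 / 2},
      csqrt (1 + (cy p ^ 2 - cx p ^ (2 * g + 1)) / cx p ^ (2 * g + 1)) ≠ 0 := fun p hp => by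
    obtain ⟨hcn, han, -, -, -⟩ := retract_estimates hp.1 hp.2
    exact csqrt_ne_zero_of_re_pos (lt_of_lt_of_le (by norm_num) (re_one_add_div_ge hcn han))
  have hR : ContinuousOn (fun p : EuclideanSpace ℝ (Fin 4) => ((Real.sqrt ((2 / ‖cx p‖) ^ (2 * g + 1)) : ℝ) : ℂ))
      {p | 2 ≤ ‖cx p‖ ∧ ‖w g p‖ ≤ 1 / 2} :=
    Complex.continuous_ofReal.comp_continuousOn (Real.continuous_sqrt.comp_continuousOn (hs.pow _))
  have hY := ((hcy.continuousOn.mul hR).mul hU).div hV hV0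
  exact continuous_mk.comp_continuousOn (hX.prodMk hY)

/-! ## The retraction of the base -/

/-- **The fibred retraction of `Base g` onto its flat part.** [cite: Milnor1968, §9] -/
def baseRetract (g : ℕ) (p : Base g) : Base g :=
  ⟨baseRetractAmb g p.1, by
    show rho g (baseRetractAmb g p.1) ≤ 1 / 4
    exact (rho_baseRetractAmb_le (norm_w_le p)).trans p.2⟩

/-- The underlying point. [folklore] -/
@[simp] theorem baseRetract_coe (p : Base g) : (baseRetract g p).1 = baseRetractAmb g p.1 := rfl

/-- **The retraction is the identity on `‖x‖ ≤ 2`** (all flat pages, the central page, the chain loops). [folklore] -/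
theorem baseRetract_eq_self {p : Base g} (h : ‖cx p.1‖ ≤ 2) : baseRetract g p = p :=
  Subtype.ext (baseRetractAmb_of_le h)

/-- **Its values have `‖x‖ ≤ 2`.** [folklore] -/
theorem norm_cx_baseRetract_le (p : Base g) : ‖cx (baseRetract g p).1‖ ≤ 2 := norm_cx_baseRetractAmb_le p.1

/-- **It is fibred**: `w ∘ baseRetract = w`. [folklore] -/
theorem w_baseRetract (p : Base g) : w g (baseRetract g p).1 = w g p.1 := w_baseRetractAmb (norm_w_le p)

/-- **The retraction is continuous** (the two formulas agree on `‖x‖ = 2`). [folklore] -/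
theorem continuous_baseRetract : Continuous (baseRetract g) := by
  refine Continuous.subtype_mk ?_ _
  show Continuous fun p : Base g => baseRetractAmb g p.1
  unfold baseRetractAmb
  refine continuous_if (fun a ha => ?_) continuous_subtype_val.continuousOn ?_
  · -- agreement on the frontier `‖x‖ = 2`
    have hfr := frontier_le_subset_eq (contDiff_cx.continuous.comp continuous_subtype_val).norm continuous_const ha
    have h2 : ‖cx a.1‖ = 2 := hfr
    obtain ⟨hc, han, hX, hy, hx0⟩ := retract_estimates (g := g) h2.ge (norm_w_le a)
    have hs : (2 / ‖cx a.1‖ : ℝ) = 1 := by rw [h2]; norm_num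
    have hv : 0 < (1 + (cy a.1 ^ 2 - cx a.1 ^ (2 * g + 1)) / cx a.1 ^ (2 * g + 1)).re :=
      lt_of_lt_of_le (by norm_num) (re_one_add_div_ge hc han)
    rw [hs]
    simp only [Complex.ofReal_one, one_mul, one_pow, Real.sqrt_one, mul_one]
    rw [mul_div_assoc, div_self (csqrt_ne_zero_of_re_pos hv), mul_one, mk_cx_cy]
  · refine (continuousOn_baseRetractAmb_outer (g := g)).comp continuous_subtype_val.continuousOn fun a ha => ?_
    have hset : {x : Base g | ¬‖cx x.1‖ ≤ 2} = {x | (2 : ℝ) < ‖cx x.1‖} := by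
      ext x; simp [not_le]
    rw [hset] at ha
    have ha2 : (2 : ℝ) ≤ ‖cx a.1‖ :=
      closure_lt_subset_le continuous_const ((contDiff_cx.continuous.comp continuous_subtype_val).norm) ha
    exact ⟨ha2, norm_w_le a⟩

end StabBase

/-! ## Registered helper -/

/-- **Registered helper `helper_baseRetract` (sub-goal of `stub_STgeo` ▸ N3-nat ▸ N3d-1 ▸ G1c `shadow_embed`, wave 8, lead c5):
the fibred retraction of `Base g` onto its flat part `‖x‖ ≤ 2` is continuous, the identity there, takes values there, and
preserves `w`.** [cite: Milnor1968, §9] -/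
theorem helper_baseRetract : ∀ (g : ℕ), Continuous (Summit.SmoothPoincare4.SmoothPoincare4.Theorems.AcyclicBisectionExists.ModpBraidOrbits.StabBase.baseRetract g) ∧ (∀ p : Literature.Topology.FourManifolds.LefschetzBase.Base g, ‖Literature.Topology.FourManifolds.LefschetzBase.cx p.1‖ ≤ 2 → Summit.SmoothPoincare4.SmoothPoincare4.Theorems.AcyclicBisectionExists.ModpBraidOrbits.StabBase.baseRetract g p = p) ∧ (∀ p : Literature.Topology.FourManifolds.LefschetzBase.Base g, ‖Literature.Topology.FourManifolds.LefschetzBase.cx (Summit.SmoothPoincare4.SmoothPoincare4.Theorems.AcyclicBisectionExists.ModpBraidOrbits.StabBase.baseRetract g p).1‖ ≤ 2 ∧ Literature.Topology.FourManifolds.LefschetzBase.w g (Summit.SmoothPoincare4.SmoothPoincare4.Theorems.AcyclicBisectionExists.ModpBraidOrbits.StabBase.baseRetract g p).1 = Literature.Topology.FourManifolds.LefschetzBase.w g p.1) :=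
  fun _ => ⟨StabBase.continuous_baseRetract, fun _ h => StabBase.baseRetract_eq_self h,
    fun p => ⟨StabBase.norm_cx_baseRetract_le p, StabBase.w_baseRetract p⟩⟩

end Summit.SmoothPoincare4.SmoothPoincare4.Theorems.AcyclicBisectionExists.ModpBraidOrbits

end
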